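import Summits.ResolutionOfSingularities.ResolutionOfSingularities.Theses.Valuative
import Summits.ResolutionOfSingularities.ResolutionOfSingularities.Theses.CyclicCovers
import Summits.ResolutionOfSingularities.ResolutionOfSingularities.Theorems.SandwichedSingularitiesResolution
import Summits.ResolutionOfSingularities.ResolutionOfSingularities.Theorems.RegularBlowupsDesingularization
import Summits.ResolutionOfSingularities.ResolutionOfSingularities.Theorems.ValuativePatchingRelQProjLine
import Summits.ResolutionOfSingularities.ResolutionOfSingularities.Theorems.ValuativePatchingRelBlowupBridge
import Summits.ResolutionOfSingularities.ResolutionOfSingularities.Theorems.ValuativePatchingRelStrongBlowup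
import Summits.ResolutionOfSingularities.ResolutionOfSingularities.Theorems.ValuativePatchingRelFormatUpgrade
import Summits.ResolutionOfSingularities.ResolutionOfSingularities.Theorems.ValuativePatchingRel
import Summits.ResolutionOfSingularities.ResolutionOfSingularities.Theorems.ValuativePatchingRelRegularBlowupLine
import Summits.ResolutionOfSingularities.ResolutionOfSingularities.Theorems.ValuativePatchingRelAxiomFourEquivalence
import Summits.ResolutionOfSingularities.ResolutionOfSingularities.Theorems.ValuativePatchingRelKollarPrincipalization
import Literature.AlgebraicGeometry.Resolution.PrincipalizationToResolutionInChar
import Literature.AlgebraicGeometry.Resolution.ProjectiveBirationalBlowup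
import Literature.AlgebraicGeometry.Resolution.QuasiExcellentSchemes
import Literature.AlgebraicGeometry.Resolution.Principalization
import HarnessLib

/-!
# Crux `PatchingRel` (stmt-ResolutionOfSingularities-0642) — line `sandwiched-gluing`, SKELETON v3.8
# (continuation lead c3, 2026-08-17: final registration — ONE open stub, every alternative a proved conditional closing)

Composition through the QUASI-PROJECTIVE blow-up atom (projective models throughout,
`Theorems.patchingRel_of_sandwichedBlowupQProj`, p106621, NO named-fact hypothesis):

  `PatchingRel ⇐ patchingRel_of_sandwichedBlowupQProj ∘ B4qp`,

* B4qp `stub_sandwichedBlowupResolutionQProj : ∀ p prime, SandwichedBlowupResolutionQProj.{0} p`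
  — THE ONLY OPEN STUB: a quasi-projective variety over a field of characteristic `p`, regular off
  an open which is proper-birational over a regular variety, is desingularised by ONE blowing up
  (= has a projective resolution, Liu 2002 Thm. 8.1.24). This is resolution of sandwiched
  singularities in characteristic `p`; OPEN in dimension `≥ 4` (Zariski 1944 two-model
  patching; Piltant 2013 p. 2; Teissier 2023 Problem C). It is crux-EQUIVALENT given LU:
  `Theorems.patchingRel_iff_lurel_imp_sandwichedLocus` (no slack) and Disproof §8/§13
  (`Res_p ⇔ TMP_p ∧ LUrel_p`).
* Every alternative closing registered by earlier leads is kept below as a PROVED conditional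
  theorem (no `sorry`): strong qp atom (QP3), Sing-admissible blow-ups of regular quasi-projective
  varieties mod `Liu2002Thm8124Projective` (L1/L2), Kollár-format principalization in char `p`
  (K1, LU idle), and — new in v3.8, the smallest honest residual in Lean — Piltant's Axiom 4 on
  regular varieties PLUS Zariski's bad-points implication `ExcAdm p → SingAdm p`
  (`patchingRel_of_liu_of_principalization_of_badPoints`).
* v3.6/v3.7 stubs A1/A2 LANDED (p136215): `exact` of the tree theorems.
-/

set_option linter.dupNamespace false

noncomputable section

namespace Summit.ResolutionOfSingularities.ResolutionOfSingularities.Cruxes.PatchingRel.SandwichedGluingLine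

open CategoryTheory AlgebraicGeometry TopologicalSpace
open Literature.AlgebraicGeometry.Resolution Literature.AlgebraicGeometry.Morphisms
open Summit.ResolutionOfSingularities.ResolutionOfSingularities

/-! ## Landed pieces (all `exact` of gate-accepted theorems) -/

/-- Stub QP3 (LANDED p106621): SAND⁺ᵇ_qp(p) ⇒ SANDᵇ_qp(p). [folklore] -/
theorem stub_sandwichedBlowupQProj_of_strongQProj :
    ∀ p : ℕ, SandwichedStrongBlowupResolutionQProj.{0} p → SandwichedBlowupResolutionQProj.{0} p :=
  Theorems.stub_sandwichedBlowupQProj_of_strongQProj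

/-- Capstone QP (LANDED p106621): the crux from the quasi-projective blow-up atom, projective
models throughout, no named fact. [cite: Piltant2013, Prop. 5.1 and Cor. 5.7] -/
theorem patchingRel_of_sandwichedBlowupQProj :
    (∀ p : ℕ, p.Prime → SandwichedBlowupResolutionQProj.{0} p) →
    Summit.ResolutionOfSingularities.ResolutionOfSingularities.Theses.Valuative.PatchingRel :=
  Theorems.patchingRel_of_sandwichedBlowupQProj

/-- Alternative closing B4′qp (LANDED p106621): the crux from the STRONG quasi-projective blow-up
atom. [cite: Piltant2013, Prop. 5.1 and Cor. 5.7] -/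
theorem patchingRel_of_sandwichedStrongBlowupQProj :
    (∀ p : ℕ, p.Prime → SandwichedStrongBlowupResolutionQProj.{0} p) →
    Summit.ResolutionOfSingularities.ResolutionOfSingularities.Theses.Valuative.PatchingRel :=
  Theorems.patchingRel_of_sandwichedStrongBlowupQProj

/-- Stub L1 (LANDED p135532 by c2): with Liu 2002 Thm. 8.1.24 the sandwiched piece
`φ⁻¹(Reg Y) → Reg Y` of a morphism of projective models is a blowing up of the regular
quasi-projective `Reg Y`, so Sing-admissible desingularization of such blowings up RegLe-ifies
projective models. [cite: Liu2002, Thm. 8.1.24] [cite: Piltant2013, Prop. 5.1 (proof, Steps 2 and 4)] -/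
theorem stub_projRegLeification_of_liu_of_regularBlowupSingAdmQProj :
    Literature.AlgebraicGeometry.Resolution.Liu2002Thm8124Projective.{0} → ∀ p : ℕ,
      RegularBlowupSingAdmissibleResolutionQProj.{0} p → ∀ (k : Type) [Field k] [CharP k p]
      (K : Type) [Field K] [Algebra k K] (M Y : Literature.AlgebraicGeometry.Resolution.ProjModel k K)
      (φ : M.Hom Y), ∃ (M1 : Literature.AlgebraicGeometry.Resolution.ProjModel k K) (ψ : M1.Hom M),
        ψ.RegLe ∧ (ψ.comp φ).RegLe :=
  Theorems.stub_projRegLeification_of_liu_of_regularBlowupSingAdmQProj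

/-- Alternative closing L2 (LANDED p135532 by c2): the crux from Sing-admissible blow-up
desingularization of blowings up of regular QUASI-PROJECTIVE varieties, CONDITIONAL on the
theorem-in-print `Liu2002Thm8124Projective`. [cite: Liu2002, Thm. 8.1.24] [cite: Piltant2013, Prop. 5.1 and Cor. 5.7] -/
theorem patchingRel_of_liu_of_regularBlowupSingAdmQProj :
    Literature.AlgebraicGeometry.Resolution.Liu2002Thm8124Projective.{0} →
    (∀ p : ℕ, p.Prime → RegularBlowupSingAdmissibleResolutionQProj.{0} p) →
    Summit.ResolutionOfSingularities.ResolutionOfSingularities.Theses.Valuative.PatchingRel :=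
  Theorems.patchingRel_of_liu_of_regularBlowupSingAdmQProj

/-- Alternative closing K1/K2 (LANDED p135752 + p135981 by c2): Kollár-format principalization
(Kollár 2007 Thm. 3.21, weak form) over all fields of characteristic `p` gives `ResolutionInChar p`
outright (LU idle). [cite: Kollar2007, Thm. 3.21 and Cor. 3.22 (pp. 124–125)] -/
theorem stub_resolutionInChar_of_kollarPrincipalizationOver :
    ∀ p : ℕ, (∀ (k : Type) [Field k] [CharP k p],
      Literature.AlgebraicGeometry.Resolution.KollarPrincipalizationOver.{0} k) →
      ResolutionInChar.{0} p :=
  fun _ h => Literature.AlgebraicGeometry.Resolution.resolutionInChar_of_kollarPrincipalizationOver h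

/-- Stub A1 (LANDED p136215 by c2): Piltant's Axiom 4 in blow-up format IS exceptional-admissible
desingularization of blowings up of regular varieties (Temkin 2008 Lemma 2.1.4 / Stacks 080A).
[cite: Temkin2008, Lemma 2.1.4] [cite: Piltant2013, §2 Axiom 4] -/
theorem stub_principalization_of_regularBlowupExcAdmissible :
    ∀ p : ℕ, RegularBlowupExcAdmissibleResolution.{0} p → PrincipalizationInChar.{0} p :=
  Theorems.stub_principalization_of_regularBlowupExcAdmissible

/-- Stub A2 (LANDED p136215 by c2): `SAND⁺ᵇ(p) ↔ SAND⁺(p) ∧ Axiom 4ᵇ(p)`.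
[cite: Piltant2013, §2 Axiom 4 and Def. 5.4] -/
theorem stub_sandwichedStrongBlowup_iff_strong_and_principalization :
    ∀ p : ℕ, SandwichedStrongBlowupResolution.{0} p ↔
      (SandwichedStrongResolution.{0} p ∧ PrincipalizationInChar.{0} p) :=
  Theorems.stub_sandwichedStrongBlowup_iff_strong_and_principalization

/-- **The smallest honest residual, in Lean (v3.8).** Modulo the theorem-in-print
`Liu2002Thm8124Projective`, the crux follows from TWO statements about REGULAR varieties in
characteristic `p`: Piltant's Axiom 4 (principalization of ideals on regular varieties by one
`V(I)`-supported blowing up with regular source — an embedded-resolution theorem, open in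
dimension `≥ 4`) and Zariski's bad-points implication `ExcAdm p → SingAdm p` (an
exceptional-admissible regular blowing up of `Bl_I U` can be traded for a SINGULAR-locus-admissible
one). Proof: Axiom 4ᵇ ⇒ ExcAdm (Stacks 080A, c1) ⇒ SingAdm (hypothesis) ⇒ SingAdm_qp ⇒ crux (L2).
[cite: Piltant2013, §2 Axiom 4, Def. 5.4 and Prop. 5.1] [cite: Liu2002, Thm. 8.1.24] -/
theorem patchingRel_of_liu_of_principalization_of_badPoints
    (hL : Literature.AlgebraicGeometry.Resolution.Liu2002Thm8124Projective.{0})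
    (hP : ∀ p : ℕ, p.Prime → PrincipalizationInChar.{0} p)
    (hB : ∀ p : ℕ, p.Prime →
      (RegularBlowupExcAdmissibleResolution.{0} p → RegularBlowupSingAdmissibleResolution.{0} p)) :
    Summit.ResolutionOfSingularities.ResolutionOfSingularities.Theses.Valuative.PatchingRel :=
  patchingRel_of_liu_of_regularBlowupSingAdmQProj hL fun p hp =>
    regularBlowupSingAdmissibleResolutionQProj_of_singAdmissible
      (hB p hp (Theorems.stub_regularBlowupExcAdmissible_of_principalization p (hP p hp)))

/-! ## The open stub -/

/-- Stub B4qp — **THE OPEN ATOM**: every quasi-projective variety with sandwiched singular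
locus, in every prime characteristic, is desingularised by one blowing up (= has a projective
resolution, Liu 8.1.24). OPEN in dimension `≥ 4` (Zariski 1944; Piltant 2013, p. 2; Teissier
2023, Problem C); crux-equivalent given LU (`Theorems.patchingRel_iff_lurel_imp_sandwichedLocus`).
[cite: Piltant2013, p. 2 (open in dimension ≥ 4)] -/
theorem stub_sandwichedBlowupResolutionQProj :
    ∀ p : ℕ, p.Prime → SandwichedBlowupResolutionQProj.{0} p := by
  sorry

/-- **Line `sandwiched-gluing` (v3.8) closes the crux modulo its single open stub B4qp.** [folklore] -/
theorem PatchingRel_of :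
    Summit.ResolutionOfSingularities.ResolutionOfSingularities.Theses.Valuative.PatchingRel :=
  patchingRel_of_sandwichedBlowupQProj stub_sandwichedBlowupResolutionQProj

end Summit.ResolutionOfSingularities.ResolutionOfSingularities.Cruxes.PatchingRel.SandwichedGluingLine

end
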